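import Summits.NavierStokesRegularity.NavierStokesRegularity.Theorems.NoOverheating.Negative.ScrewWindowsExcluded
import Summits.NavierStokesRegularity.NavierStokesRegularity.Theorems.DssFarFieldSlavingBlowupTypeIDssProfileFiniteOrderTwist
import Literature.Analysis.FluidPDE.PineauVicolRDSSLiouvilleHolds

/-!
# KJ-36 — POWERS of the DSS-rotation: slow screws UP TO A POWER (in particular the squares of
# IMPROPER rotations) are EXCLUDED below Pineau–Vicol's threshold from the window sequences of
# route `AngularGalerkinLadder` (Pineau–Vicol 2026, Theorem 1.7 (i); Bradshaw–Tsai 2017 §1)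

Refuter lineage, Negative lane of crux K2 `NoOverheating` (supports, does not decide).  KJ-35
excluded window sequences whose DSS-rotations `Rₙ` are slow screws `gₙ R_{θₙ} gₙ⁻¹`; improper
`Rₙ` (rotoreflections) escaped.  A `(c, R)`-RDSS field is `(c^q, R^q)`-RDSS (tree:
`isRotatedDSS_pow`), so a window profile with data `(c, R)` in the window `[cmin, cmax]` is one
with data `(c^q, R^q)` in `[cmin^q, cmax^q]` (`isWindowProfile_pow`); and the square of an
improper isometry of `ℝ³` is proper.  Hence:
* `no_windowSequence_powSlowScrew` — for every `C₀` there are `α₁ > 0`, `c₁ > 1` (Pineau–Vicol's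
  regime (i) thresholds) such that no admissible window sequence has `q`-th powers
  `Rₙ^q = gₙ R_{θₙ} gₙ⁻¹` that are slow screws, `|θₙ| ≤ 2 α₁ · q log cₙ`, with `cmax^q < c₁` (§2);
* `no_windowSequence_sqSlowScrew` — the case `q = 2`, phrased on `Rₙ ∘ Rₙ`: slow ROTOREFLECTIONS
  (and slow screws) with `cmax² < c₁(C₀)` are excluded (§3);
* `not_cofinal_and_noOverheating_sqSlowScrew` — the reading on K1 ∧ K2 (§3).
WHAT ESCAPES: rotations / rotoreflections whose square twists in Pineau–Vicol's open middle range,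
coarse windows `cmax^q ≥ c₁`.  WHAT THIS IS NOT: not `¬NoOverheating` (vacuous without K1
instances), no new Literature fact, no definition, standard axioms only; the Euler axis–angle
normal form (every proper isometry of `ℝ³` IS some `g R_θ g⁻¹`) is not in the tree, so the screw
shape of `Rₙ^q` is a HYPOTHESIS here, discharged by inspection for any concrete family.
[cite: PineauVicol2026, Theorem 1.7 (i) and (1.13) (arXiv:2607.09619 p. 7)]
[cite: BradshawTsai2017CPDE, §1 (rotated discretely self-similar fields, arXiv:1610.05680 p. 4)] -/

namespace Summit.NavierStokesRegularity.AngularGalerkinLadderPowerScrewWindowsExcluded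

open Set Filter MeasureTheory Topology Function
open Literature.Analysis Literature.Analysis.FluidPDE
open Summit.NavierStokesRegularity.FluidComputer
open Summit.NavierStokesRegularity.NavierStokesRegularity.Theses.AngularGalerkinLadder
open Summit.NavierStokesRegularity.NavierStokesRegularity.Theorems
open Summit.NavierStokesRegularity.AngularGalerkinLadderFineRatioWindowsExcluded
open Summit.NavierStokesRegularity.AngularGalerkinLadderScrewWindowsExcluded

/-! ### §1 Power transport of a window profile -/

/-- A window rung profile with DSS data `(c, R)` in the window `[cmin, cmax]` (`0 ≤ cmin`) is a
window rung profile with data `(c^q, R^q)` in the window `[cmin^q, cmax^q]` for every `q ≥ 1`: the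
rung equation, the Type-I bound, the amplitude floor and the defect bound do not see `(c, R)`, and
`(c, R)`-RDSS implies `(c^q, R^q)`-RDSS. [cite: BradshawTsai2017CPDE, §1] -/
theorem isWindowProfile_pow {L : ℕ} {C₀ cmin cmax δ ε c : ℝ}
    {R : EuclideanSpace ℝ (Fin 3) ≃ₗᵢ[ℝ] EuclideanSpace ℝ (Fin 3)}
    {u : ℝ → EuclideanSpace ℝ (Fin 3) → EuclideanSpace ℝ (Fin 3)}
    {p : ℝ → EuclideanSpace ℝ (Fin 3) → ℝ}
    {d : ℝ → EuclideanSpace ℝ (Fin 3) → EuclideanSpace ℝ (Fin 3)} (hcmin : 0 ≤ cmin) {q : ℕ}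
    (hq : 0 < q) (hW : AngularLadder.IsWindowProfile L C₀ cmin cmax δ ε c R u p d) :
    AngularLadder.IsWindowProfile L C₀ (cmin ^ q) (cmax ^ q) δ ε (c ^ q) (R ^ q) u p d := by
  obtain ⟨⟨hsol, hc, hdss, hTI⟩, hlo, hhi, hamp, hdef⟩ := hW
  exact ⟨⟨hsol, one_lt_pow₀ hc hq.ne', isRotatedDSS_pow hdss q, hTI⟩,
    pow_le_pow_left₀ hcmin hlo q, pow_le_pow_left₀ (zero_le_one.trans hc.le) hhi q, hamp, hdef⟩

/-! ### §2 Slow screws up to a power -/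

/-- **No admissible window sequence whose DSS-rotations are slow screws UP TO A POWER.**  For
every `C₀` there are `α₁ > 0` and `c₁ > 1` (Pineau–Vicol 2026, Thm 1.7 (i)) such that for every
`q ≥ 1`: constants `1 < cmin`, `0 < δ`, `εₙ → 0`, a window rung profile with constant `C₀` and
window `[cmin, cmax]` at every index, whose DSS-rotations have `q`-th powers `Rₙ^q = gₙ R_{θₙ} gₙ⁻¹`
(screws about ANY varying axes) with `|θₙ| ≤ 2 α₁ · q log cₙ` (speed `≤ α₁` at the period
`2 log cₙ^q`), and `cmax^q < c₁`, are contradictory (`isWindowProfile_pow` + the KJ-35 transport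
`no_windowSequence_screw_core` at the data `(cₙ^q, Rₙ^q)`); `C₀ ≤ 0` is vacuous.
[cite: PineauVicol2026, Theorem 1.7 (i) (arXiv:2607.09619 p. 7)] -/
theorem no_windowSequence_powSlowScrew (C₀ : ℝ) :
    ∃ α₁ : ℝ, 0 < α₁ ∧ ∃ c₁ : ℝ, 1 < c₁ ∧ ∀ {q : ℕ} {cmin cmax δ : ℝ} {L : ℕ → ℕ}
      {ε c θ : ℕ → ℝ} {R g : ℕ → (EuclideanSpace ℝ (Fin 3) ≃ₗᵢ[ℝ] EuclideanSpace ℝ (Fin 3))}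
      {u : ℕ → ℝ → EuclideanSpace ℝ (Fin 3) → EuclideanSpace ℝ (Fin 3)}
      {p : ℕ → ℝ → EuclideanSpace ℝ (Fin 3) → ℝ}
      {d : ℕ → ℝ → EuclideanSpace ℝ (Fin 3) → EuclideanSpace ℝ (Fin 3)},
      0 < q → cmax ^ q < c₁ → 1 < cmin → 0 < δ → Tendsto ε atTop (𝓝 0) →
      (∀ n, AngularLadder.IsWindowProfile (L n) C₀ cmin cmax δ (ε n) (c n) (R n) (u n) (p n)
        (d n)) →
      (∀ n x, ((R n) ^ q) x = g n (rotZ (θ n) ((g n).symm x))) →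
      (∀ n, |θ n| ≤ 2 * α₁ * (q * Real.log (c n))) → False := by
  by_cases hC₀ : 0 < C₀
  · obtain ⟨α₁, c₁, hα₁, hc₁, PV⟩ := (pineauVicol2026_rdss_liouville_holds C₀ hC₀).1
    refine ⟨α₁, hα₁, c₁, hc₁,
      fun {q cmin cmax δ L ε c θ R g u p d} hq hcmax hcmin hδ hε hW hconj hθ => ?_⟩
    have hcpos : ∀ n, 0 < c n := fun n => (one_pos.trans hcmin).trans_le (hW n).2.1
    have hWq : ∀ n, AngularLadder.IsWindowProfile (L n) C₀ (cmin ^ q) (cmax ^ q) δ (ε n)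
        (c n ^ q) (R n ^ q) (u n) (p n) (d n) :=
      fun n => isWindowProfile_pow (zero_le_one.trans hcmin.le) hq (hW n)
    have hθ' : ∀ n, |θ n| ≤ 2 * α₁ * Real.log (c n ^ q) := fun n => by
      rw [Real.log_pow]; exact hθ n
    refine no_windowSequence_screw_core
      (fun θ' c' => |(-θ') / (2 * Real.log c')| ≤ α₁ ∧ c' < c₁)
      (fun θ' c' hQ hc' w P U hcl hTI hU hper hans =>
        PV _ c' w P U hQ.1 hc' hQ.2 hcl hTI hU hper hans)
      (B := 2 * α₁ * Real.log (cmax ^ q)) (one_lt_pow₀ hcmin hq.ne') hδ hε hWq hconj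
      (fun n => (hθ' n).trans (mul_le_mul_of_nonneg_left
        (Real.log_le_log (pow_pos (hcpos n) q) (hWq n).2.2.1) (by positivity)))
      fun κ θ' c' _ hθlim hclim => ?_
    have hc'le : c' ≤ cmax ^ q := le_of_tendsto' hclim fun n => (hWq (κ n)).2.2.1
    have hc' : 1 < c' :=
      (one_lt_pow₀ hcmin hq.ne').trans_le (ge_of_tendsto' hclim fun n => (hWq (κ n)).2.1)
    have hlogc : 0 < Real.log c' := Real.log_pos hc'
    have hθ'' : |θ'| ≤ 2 * α₁ * Real.log c' :=
      le_of_tendsto_of_tendsto' hθlim.abs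
        (((Real.continuousAt_log (one_pos.trans hc').ne').tendsto.comp hclim).const_mul _)
        fun n => hθ' _
    refine ⟨?_, lt_of_le_of_lt hc'le hcmax⟩
    rw [abs_div, abs_neg, abs_of_pos (mul_pos two_pos hlogc), div_le_iff₀ (mul_pos two_pos hlogc)]
    linarith
  · refine ⟨1, one_pos, 2, one_lt_two,
      fun {q cmin cmax δ L ε c θ R g u p d} _ _ _ hδ _ hW _ _ => ?_⟩
    exact hC₀ (typeI_const_pos_of_window hδ (hW 0))

/-! ### §3 Squares: slow rotoreflections are excluded -/

/-- **Slow ROTOREFLECTIONS (and slow screws) with `cmax² < c₁(C₀)` are excluded.**  The case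
`q = 2` of `no_windowSequence_powSlowScrew`, phrased on `Rₙ ∘ Rₙ`: if each `Rₙ ∘ Rₙ` is a screw
`gₙ R_{θₙ} gₙ⁻¹` with `|θₙ| ≤ 4 α₁ log cₙ` and `cmax² < c₁`, there is no admissible window sequence.
For an improper `Rₙ` (determinant `−1`) of `ℝ³`, `Rₙ ∘ Rₙ` is proper, hence a rotation about an
axis: for the rotoreflection `S_θ = R_θ ∘ (z ↦ −z)` one has `S_θ ∘ S_θ = R_{2θ}`, so slow
rotoreflections `|θₙ| ≤ 2 α₁ log cₙ` fall under this theorem.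
[cite: PineauVicol2026, Theorem 1.7 (i) (arXiv:2607.09619 p. 7)] -/
theorem no_windowSequence_sqSlowScrew (C₀ : ℝ) :
    ∃ α₁ : ℝ, 0 < α₁ ∧ ∃ c₁ : ℝ, 1 < c₁ ∧ ∀ {cmin cmax δ : ℝ} {L : ℕ → ℕ}
      {ε c θ : ℕ → ℝ} {R g : ℕ → (EuclideanSpace ℝ (Fin 3) ≃ₗᵢ[ℝ] EuclideanSpace ℝ (Fin 3))}
      {u : ℕ → ℝ → EuclideanSpace ℝ (Fin 3) → EuclideanSpace ℝ (Fin 3)}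
      {p : ℕ → ℝ → EuclideanSpace ℝ (Fin 3) → ℝ}
      {d : ℕ → ℝ → EuclideanSpace ℝ (Fin 3) → EuclideanSpace ℝ (Fin 3)},
      cmax ^ 2 < c₁ → 1 < cmin → 0 < δ → Tendsto ε atTop (𝓝 0) →
      (∀ n, AngularLadder.IsWindowProfile (L n) C₀ cmin cmax δ (ε n) (c n) (R n) (u n) (p n)
        (d n)) →
      (∀ n x, R n (R n x) = g n (rotZ (θ n) ((g n).symm x))) →
      (∀ n, |θ n| ≤ 4 * α₁ * Real.log (c n)) → False := by
  obtain ⟨α₁, hα₁, c₁, hc₁, H⟩ := no_windowSequence_powSlowScrew C₀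
  refine ⟨α₁, hα₁, c₁, hc₁, fun {cmin cmax δ L ε c θ R g u p d} hcmax hcmin hδ hε hW hsq hθ => ?_⟩
  refine H (g := g) (θ := θ) two_pos hcmax hcmin hδ hε hW (fun n x => ?_) fun n => ?_
  · rw [← hsq n x]; rfl
  · have := hθ n; push_cast; linarith

/-- **K1 ∧ (K2 on the stratum of slow rotoreflections / slow screws with `cmax² < c₁(C₀)`) is
FALSE**: for every `C₀` there are `α₁ > 0`, `c₁ > 1` such that `RungBlowupCofinal` and a
`NoOverheating` with constant `C₀`, `cmax² < c₁` and window profiles whose DSS-rotation `R` has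
`R ∘ R` a rotation by an angle `|θ| ≤ 4 α₁ log c` about some axis are contradictory.
[cite: PineauVicol2026, Theorem 1.7 (i)] -/
theorem not_cofinal_and_noOverheating_sqSlowScrew (C₀ : ℝ) :
    ∃ α₁ : ℝ, 0 < α₁ ∧ ∃ c₁ : ℝ, 1 < c₁ ∧ ¬ (RungBlowupCofinal ∧
      ∃ (cmin cmax δ : ℝ) (L₀ : ℕ) (ε : ℕ → ℝ), cmax ^ 2 < c₁ ∧ 1 < cmin ∧ 0 < δ ∧
        Tendsto ε atTop (𝓝 0) ∧
        ∀ L ≥ L₀, AngularLadder.RungIsSingular L →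
          ∃ (c : ℝ) (R : EuclideanSpace ℝ (Fin 3) ≃ₗᵢ[ℝ] EuclideanSpace ℝ (Fin 3))
            (u : ℝ → EuclideanSpace ℝ (Fin 3) → EuclideanSpace ℝ (Fin 3))
            (p : ℝ → EuclideanSpace ℝ (Fin 3) → ℝ)
            (d : ℝ → EuclideanSpace ℝ (Fin 3) → EuclideanSpace ℝ (Fin 3))
            (g : EuclideanSpace ℝ (Fin 3) ≃ₗᵢ[ℝ] EuclideanSpace ℝ (Fin 3)) (θ : ℝ),
            AngularLadder.IsWindowProfile L C₀ cmin cmax δ (ε L) c R u p d ∧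
              (∀ x, R (R x) = g (rotZ θ (g.symm x))) ∧ |θ| ≤ 4 * α₁ * Real.log c) := by
  obtain ⟨α₁, hα₁, c₁, hc₁, H⟩ := no_windowSequence_sqSlowScrew C₀
  refine ⟨α₁, hα₁, c₁, hc₁, ?_⟩
  rintro ⟨h₁, cmin, cmax, δ, L₀, ε, hcmax, hcmin, hδ, hε, hwin⟩
  choose L hLge hLsing using fun n : ℕ => h₁ (max L₀ n)
  choose c R u p d g θ hW hsq hθ using fun n : ℕ =>
    hwin (L n) (le_trans (le_max_left _ _) (hLge n)) (hLsing n)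
  have hε' : Tendsto (fun n : ℕ => ε (L n)) atTop (𝓝 0) :=
    hε.comp (tendsto_atTop_mono (fun n => le_trans (le_max_right _ _) (hLge n)) tendsto_id)
  exact H hcmax hcmin hδ hε' hW hsq hθ

/-- Census edge on K1: a `NoOverheating` met on the slow-rotoreflection / slow-screw stratum with
`cmax² < c₁(C₀)` refutes `RungBlowupCofinal`. [cite: PineauVicol2026, Theorem 1.7 (i)] -/
theorem rungBlowupCofinal_false_of_noOverheating_sqSlowScrew (C₀ : ℝ) :
    ∃ α₁ : ℝ, 0 < α₁ ∧ ∃ c₁ : ℝ, 1 < c₁ ∧ ∀ {cmin cmax δ : ℝ} {L₀ : ℕ} {ε : ℕ → ℝ},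
      cmax ^ 2 < c₁ → 1 < cmin → 0 < δ → Tendsto ε atTop (𝓝 0) →
      (∀ L ≥ L₀, AngularLadder.RungIsSingular L →
        ∃ (c : ℝ) (R : EuclideanSpace ℝ (Fin 3) ≃ₗᵢ[ℝ] EuclideanSpace ℝ (Fin 3))
          (u : ℝ → EuclideanSpace ℝ (Fin 3) → EuclideanSpace ℝ (Fin 3))
          (p : ℝ → EuclideanSpace ℝ (Fin 3) → ℝ)
          (d : ℝ → EuclideanSpace ℝ (Fin 3) → EuclideanSpace ℝ (Fin 3))
          (g : EuclideanSpace ℝ (Fin 3) ≃ₗᵢ[ℝ] EuclideanSpace ℝ (Fin 3)) (θ : ℝ),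
          AngularLadder.IsWindowProfile L C₀ cmin cmax δ (ε L) c R u p d ∧
            (∀ x, R (R x) = g (rotZ θ (g.symm x))) ∧ |θ| ≤ 4 * α₁ * Real.log c) →
      ¬ RungBlowupCofinal := by
  obtain ⟨α₁, hα₁, c₁, hc₁, H⟩ := not_cofinal_and_noOverheating_sqSlowScrew C₀
  exact ⟨α₁, hα₁, c₁, hc₁, fun {cmin cmax δ L₀ ε} hcmax hcmin hδ hε hwin h₁ =>
    H ⟨h₁, cmin, cmax, δ, L₀, ε, hcmax, hcmin, hδ, hε, hwin⟩⟩

end Summit.NavierStokesRegularity.AngularGalerkinLadderPowerScrewWindowsExcluded
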